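import Mathlib
import HarnessLib

/-!
# HomotopyS4FoldMap

Topic `Literature/Topology/FourManifolds`. Named literature fact(s) relocated by the gate from `Summits/SmoothPoincare4/SmoothPoincare4/Theorems/SymplecticOrigamiFoldedSphereFoldExistence.lean`
(accept-time relocation of `[cite]`d propositions written inline in a Summits proposal; human ruling 2026-08-15).
Sources: Gromov1986.

* `Literature.Topology.FourManifolds.eliashberg_foldMap_homotopySphere_four`
-/

namespace Literature.Topology.FourManifolds

open scoped Manifold ContDiff Topology ContinuousMap

/-- **Eliashberg's equidimensional folding theorem, instance: every smooth homotopy 4-sphere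
admits a smooth map to `ℝ⁴` folding exactly along the boundary 3-sphere of a coordinate ball.**
Y. Eliashberg, *On singularities of folding type*, Izv. Akad. Nauk SSSR Ser. Mat. 34 (1970)
1110–1126 (Math. USSR Izv. 4 (1970) 1119–1134), main theorem, in the form printed in M. Gromov,
*Partial Differential Relations* (1986), §2.1.3 (D) "The Equidimensional Folding Theorem of
Eliashberg" (Theorem, p. 59): for `n ≥ 2`, a normally oriented hypersurface `Σ ⊂ V` and a
continuous `f₀ : V → W` (`dim V = dim W = n`) covered by a fibrewise isomorphism `T̃ → T(W)` of the
`Σ`-folded tangent bundle `T̃`, there is a `C^∞` map `f : V → W` which folds along `Σ` (regular on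
`V ∖ Σ`; near each point of `Σ` equal to `(u₁, …, uₙ) ↦ (u₁², u₂, …, uₙ)` in local coordinates of
`V` and `W`, `Σ = {u₁ = 0}`, ibid. §1.3.1 (B) p. 27). INSTANCE (`V = M` a smooth homotopy
4-sphere, `W = ℝ⁴`, `Σ = e(S³)` the boundary of a coordinate ball): the formal datum exists —
`T̃ ⊕ ℝ ≅ TM ⊕ ℝ` (Cannas da Silva 2010, Lemma 1) is trivial since `M` is s-parallelisable
(Kervaire–Milnor 1963, Thm. 3.1), and for one of the two coorientations of `Σ` the Euler
number of `T̃ = TM ♯ (∓1)·TS⁴` is `χ(M) - 2 = 0` (Eliashberg 1970; Cannas da Silva 2010, §4: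
"`E ♯ k TSᵐ` has Euler characteristic `χ(E) + 2k`"), so `T̃` is trivial (Dold–Whitney 1959:
stably isomorphic oriented rank-`2n` bundles over a connected `2n`-manifold with equal Euler
numbers are isomorphic, as used in Cannas da Silva 2010, §4); for `M = S⁴`, `Σ` the equator, this
is Gromov's Example loc. cit. and `f` is the linear projection `S⁴ ⊂ ℝ⁵ → ℝ⁴`. Lean reading
(only existence is recorded, not the homotopy / `C⁰`-density clauses): for every Hausdorff
second-countable `C^∞` 4-manifold `M` homotopy equivalent to `S⁴` there are `e : ℝ⁴ → M`, `C^∞`,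
a topological embedding with injective differential, and `f : M → ℝ⁴`, `C^∞`, with injective
differential off `Z = e(S³)`, such that every point of `Z` lies in the source of a chart `φ` of
the maximal `C^∞` atlas of `M`, mapped by `f` into the source of a chart `ψ` of the maximal
`C^∞` atlas of `ℝ⁴`, with `ψ (f x) = φ x + ((φ x)₀² - (φ x)₀) e₀` (i.e. `(u₀², u₁, u₂, u₃)`) on
`φ.source` and `Z ∩ φ.source = {(φ x)₀ = 0}`.
References: Eliashberg 1970 (main theorem) [Eliashberg1970]; Gromov 1986, §2.1.3 (D) Theorem p. 59 and
Example [Gromov1986]; Kervaire–Milnor 1963, Thm. 3.1 [KervaireMilnorAnnals1963]; Cannas da Silva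
2010, Lemma 1 and §4 [Cannasdasilva2010].
[cite: Gromov1986, §2.1.3 (D) Theorem p. 59] [file Topology/FourManifolds/HomotopyS4FoldMap] -/
def eliashberg_foldMap_homotopySphere_four : Prop :=
  ∀ (M : Type) [TopologicalSpace M] [T2Space M] [SecondCountableTopology M]
    [ChartedSpace (EuclideanSpace ℝ (Fin 4)) M] [IsManifold (𝓡 4) ∞ M],
    M ≃ₕ Metric.sphere (0 : EuclideanSpace ℝ (Fin 5)) 1 →
    ∃ (e : EuclideanSpace ℝ (Fin 4) → M) (f : M → EuclideanSpace ℝ (Fin 4)),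
      ContMDiff (𝓡 4) (𝓡 4) ∞ e ∧ Topology.IsEmbedding e ∧
      (∀ y, Function.Injective (mfderiv (𝓡 4) (𝓡 4) e y)) ∧
      ContMDiff (𝓡 4) (𝓡 4) ∞ f ∧
      (∀ x, x ∉ Set.range (fun n : Metric.sphere (0 : EuclideanSpace ℝ (Fin 4)) 1 => e n) →
        Function.Injective (mfderiv (𝓡 4) (𝓡 4) f x)) ∧
      (∀ n : Metric.sphere (0 : EuclideanSpace ℝ (Fin 4)) 1,
        ∃ (φ : OpenPartialHomeomorph M (EuclideanSpace ℝ (Fin 4)))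
          (ψ : OpenPartialHomeomorph (EuclideanSpace ℝ (Fin 4)) (EuclideanSpace ℝ (Fin 4))),
          e n ∈ φ.source ∧ φ ∈ IsManifold.maximalAtlas (𝓡 4) ∞ M ∧
          ψ ∈ IsManifold.maximalAtlas (𝓡 4) ∞ (EuclideanSpace ℝ (Fin 4)) ∧
          φ.source ⊆ f ⁻¹' ψ.source ∧
          (∀ x ∈ φ.source, ψ (f x) = φ x + ((φ x 0) ^ 2 - φ x 0) •
            EuclideanSpace.single (0 : Fin 4) (1 : ℝ)) ∧
          (∀ x ∈ φ.source,
            x ∈ Set.range (fun n : Metric.sphere (0 : EuclideanSpace ℝ (Fin 4)) 1 => e n) ↔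
              φ x 0 = 0))

/-! ### The item, modulo the named fact -/

end Literature.Topology.FourManifolds
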